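import Literature.Computability.Complexity.PolynomialEntropyApproximation
import Mathlib.MeasureTheory.Measure.MeasureSpace

/-!
# PneNP / SzkEntropy — crux `PeaWorstToAvg` (stmt-PneNP-10777), negative side:
# what a MODE-PRESERVING ENCODER cannot be (obstruction calculus for `stub_modeEncoding`)

Standing-disprover content (`Cruxes/PeaWorstToAvg/Disproof.lean` §8, line `dual-mode-compile`, closing
stub `stub_modeEncoding : Nonempty ModeKit`).  A `ModeKit` asks for ONE randomized map `enc` whose law on
every YES (resp. NO) instance `x` of `PEA 3` is dominated, event by event, by the law of a fixed certified
sampler `samp true` (resp. `samp false`) on `1^{|x|}`: `enc.pr x E ≤ d · (samp b).pr 1^{|x|} E + ε`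
(registered kit: `d = 1`, `ε = 1/16`; the gen-2 planner's domination form: `d = dom(|x|)`, `ε = slack`),
the two certified laws living on the two DISJOINT sides of `BPEA`.  PMF-level facts (they apply to every
kit variant via `RandAlg.pr = toReal ∘ toOuterMeasure ∘ outputPMF`):
* `card_mul_le_of_dominated_classes'` / `card_mul_le_of_dominated_classes` — INVARIANT COUNTING (the gen-1
  §6 lemma, re-proved, robust form): `K` laws `(d, ε)`-dominated by ONE law and giving pairwise disjoint
  events mass `≥ 1 - η` (resp. `= 1`) satisfy `K(1-η-ε) ≤ d`; so an encoder transporting ANY invariant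
  (entropy up to a shift, `GL`/affine orbit, isomorphism class, rank profile …) even approximately serves
  `≤ d/(1-η-ε)` classes per length — ONE class in the registered TV form
  (`not_close_of_mostly_carried_disjoint`, `not_close_of_carried_disjoint`, `eq_of_close_of_carried`);
* `sub_le_of_close_to_separated` — the encoder SEPARATES the promise: laws on a yes- and a no-instance of
  one length differ by `≥ 1 - 2ε` on `BPEA.no` (SRE correctness vs. privacy, Applebaum–Raykov);
* `pure_eq_of_close`, `le_apply_of_pure_close`, `le_apply_of_atom_close` — DETERMINISTIC encoders collapse to
  one `(1-ε)`-atom of the certified law per length (hence decide `PEA₃` by sampling that atom);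
* `pea_no_entropyExact_encoder`, `pea_exactInvariant_eq_on_witnesses`, `pea_not_mostly_separated_witnesses` —
  the CONCRETE `PEA` corollaries: the yes-instances `(x ↦ (x₂,x₃), 0)` and `(x ↦ (x₂,x₂), 0)` on `F₂⁴`
  (every `PEA d`, `d ≥ 1`) have codes of EQUAL length and entropies `2 ≠ 1` (`pea_witnesses_spec`), so no
  encoder `ε`-close (`ε < 1/2`) per length to one law transports the entropy exactly (up to any shift of
  the length), nor any invariant separating the two, nor sends them into disjoint target classes with
  probability `≥ 1 - η` when `η + ε < 1/2` — barrier B1/B2 of the line card as a theorem: `GL`/affine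
  re-randomisation, direct sums/products with fixed gadgets, AIK re-encodings of the given map and their
  compositions are not mode kits.

References: B. Applebaum, P. Raykov, *On the relationship between statistical zero-knowledge and
statistical randomized encodings*, CRYPTO 2016 (III), Thm. 1 and 3; A. Bogdanov, L. Trevisan,
*Average-Case Complexity* (2006), Def. 3.1; J. Feigenbaum, L. Fortnow, *Random self-reducibility of
complete sets*, SIAM J. Comput. 22 (1993); Z. Dvir, D. Gutfreund, G. N. Rothblum, S. Vadhan, ICS 2011.
-/

namespace Summit.PneNP.PneNP.Theorems

open Literature.Computability.Complexity
open _root_.Computability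


open scoped ENNReal
open MeasureTheory

variable {α : Type*}

/-! ### Two facts about the outer measure of a probability mass function -/

/-- `q(E) + q(Eᶜ) = 1`. [folklore] -/
theorem toOuterMeasure_add_compl_eq_one (q : PMF α) (E : Set α) :
    q.toOuterMeasure E + q.toOuterMeasure Eᶜ = 1 := by
  rw [PMF.toOuterMeasure_apply, PMF.toOuterMeasure_apply, ← ENNReal.tsum_add, ← q.tsum_coe]
  refine tsum_congr fun x => ?_
  exact Set.indicator_self_add_compl_apply E q x

/-- `q(E) + q(Eᶜ) = 1`, real form. [folklore] -/
theorem toReal_toOuterMeasure_add_compl (q : PMF α) (E : Set α) :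
    (q.toOuterMeasure E).toReal + (q.toOuterMeasure Eᶜ).toReal = 1 := by
  have h := toOuterMeasure_add_compl_eq_one q E
  rw [← ENNReal.toReal_add (ne_top_of_le_ne_top ENNReal.one_ne_top (le_of_le_of_eq le_self_add h))
    (ne_top_of_le_ne_top ENNReal.one_ne_top (le_of_le_of_eq le_add_self h)), h, ENNReal.toReal_one]

/-- `q(E) ≤ 1`, real form. [folklore] -/
theorem toReal_toOuterMeasure_le_one (q : PMF α) (E : Set α) : (q.toOuterMeasure E).toReal ≤ 1 := by
  linarith [toReal_toOuterMeasure_add_compl q E, (ENNReal.toReal_nonneg : 0 ≤ (q.toOuterMeasure Eᶜ).toReal)]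

/-- **Finite additivity bound**: the masses of pairwise disjoint events sum to at most `1`. [folklore] -/
theorem sum_toReal_toOuterMeasure_le_one {ι : Type*} (q : PMF α) (S : Finset ι) (E : ι → Set α)
    (hdisj : (S : Set ι).PairwiseDisjoint E) :
    ∑ i ∈ S, (q.toOuterMeasure (E i)).toReal ≤ 1 := by
  letI : MeasurableSpace α := ⊤
  have hm : ∀ s : Set α, MeasurableSet s := fun _ => MeasurableSpace.measurableSet_top
  have h1 : ∀ i ∈ S, (q.toOuterMeasure (E i)).toReal = (q.toMeasure (E i)).toReal := by
    intro i _
    rw [PMF.toMeasure_apply_eq_toOuterMeasure_apply _ (hm _)]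
  rw [Finset.sum_congr rfl h1, ← ENNReal.toReal_sum fun i _ => measure_ne_top _ _,
    ← measure_biUnion_finset hdisj fun i _ => hm _]
  exact ENNReal.toReal_le_of_le_ofReal zero_le_one (by simpa using prob_le_one)

/-- **Invariant counting, robust form.** Laws `p i`, `i ∈ S`, each `(d, ε)`-dominated by one law `q`, each
giving ITS event `E i` mass `≥ 1 - η`, the `E i` pairwise disjoint: `|S| · (1 - η - ε) ≤ d`.  So an encoder
that transports an invariant only APPROXIMATELY (lands in the right class with probability `≥ 1 - η`)
still serves at most `d/(1-η-ε)` classes per length. [BogdanovTrevisan2006, Def. 3.1; FeigenbaumFortnow1993] -/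
theorem card_mul_le_of_dominated_classes' {ι : Type*} (q : PMF α) (S : Finset ι) (p : ι → PMF α)
    (E : ι → Set α) {d ε η : ℝ} (hd : 0 ≤ d) (hdisj : (S : Set ι).PairwiseDisjoint E)
    (hcar : ∀ i ∈ S, 1 - η ≤ ((p i).toOuterMeasure (E i)).toReal)
    (hdom : ∀ i ∈ S, ∀ F : Set α,
      ((p i).toOuterMeasure F).toReal ≤ d * (q.toOuterMeasure F).toReal + ε) :
    (S.card : ℝ) * (1 - η - ε) ≤ d := by
  have hsum : ∑ i ∈ S, ((p i).toOuterMeasure (E i)).toReal ≤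
      ∑ i ∈ S, (d * (q.toOuterMeasure (E i)).toReal + ε) :=
    Finset.sum_le_sum fun i hi => hdom i hi (E i)
  have hlow : ∑ i ∈ S, (1 - η) ≤ ∑ i ∈ S, ((p i).toOuterMeasure (E i)).toReal :=
    Finset.sum_le_sum fun i hi => hcar i hi
  rw [Finset.sum_const, nsmul_eq_mul] at hlow
  rw [Finset.sum_add_distrib, Finset.sum_const, nsmul_eq_mul, ← Finset.mul_sum] at hsum
  have hq := sum_toReal_toOuterMeasure_le_one q S E hdisj
  have : d * ∑ i ∈ S, (q.toOuterMeasure (E i)).toReal ≤ d * 1 := mul_le_mul_of_nonneg_left hq hd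
  nlinarith

/-- **Two approximately transported classes kill a TV-close encoder** as soon as `η + ε < 1/2`.
[ApplebaumRaykov2016, Thm. 1; FeigenbaumFortnow1993] -/
theorem not_close_of_mostly_carried_disjoint (q p₁ p₂ : PMF α) {E₁ E₂ : Set α} {ε η : ℝ}
    (hεη : η + ε < 1 / 2) (hdisj : Disjoint E₁ E₂) (hc₁ : 1 - η ≤ (p₁.toOuterMeasure E₁).toReal)
    (hc₂ : 1 - η ≤ (p₂.toOuterMeasure E₂).toReal)
    (h₁ : ∀ F : Set α, (p₁.toOuterMeasure F).toReal ≤ (q.toOuterMeasure F).toReal + ε)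
    (h₂ : ∀ F : Set α, (p₂.toOuterMeasure F).toReal ≤ (q.toOuterMeasure F).toReal + ε) : False := by
  classical
  have h := card_mul_le_of_dominated_classes' (ι := Bool) q Finset.univ (fun b => if b then p₁ else p₂)
    (fun b => if b then E₁ else E₂) (d := 1) (ε := ε) (η := η) zero_le_one ?_ ?_ ?_
  · simp only [Finset.card_univ, Fintype.card_bool, Nat.cast_ofNat] at h
    linarith
  · intro a _ b _ hab
    cases a <;> cases b <;> simp_all [Function.onFun, disjoint_comm]
  · intro b _
    cases b
    · exact hc₂
    · exact hc₁
  · intro b _ F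
    cases b <;> simpa using (by first | exact h₂ F | exact h₁ F)


/-- **Invariant counting under domination.** If each of the laws `p i`, `i ∈ S`, is `(d, ε)`-dominated by
ONE law `q` (`p i (F) ≤ d · q(F) + ε` for every event `F`) and is CARRIED by the event `E i`
(`p i (E i) = 1`), the `E i` pairwise disjoint, then `|S| · (1 - ε) ≤ d`.  For a mode kit: an encoder that
transports an invariant exactly serves at most `d/(1-ε)` invariant classes among the yes- (resp. no-)
instances of each length. [BogdanovTrevisan2006, Def. 3.1; FeigenbaumFortnow1993] -/
theorem card_mul_le_of_dominated_classes {ι : Type*} (q : PMF α) (S : Finset ι) (p : ι → PMF α)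
    (E : ι → Set α) {d ε : ℝ} (hd : 0 ≤ d) (hdisj : (S : Set ι).PairwiseDisjoint E)
    (hcar : ∀ i ∈ S, ((p i).toOuterMeasure (E i)).toReal = 1)
    (hdom : ∀ i ∈ S, ∀ F : Set α,
      ((p i).toOuterMeasure F).toReal ≤ d * (q.toOuterMeasure F).toReal + ε) :
    (S.card : ℝ) * (1 - ε) ≤ d := by
  have h := card_mul_le_of_dominated_classes' q S p E (η := 0) hd hdisj
    (fun i hi => by rw [hcar i hi]; norm_num) hdom
  simpa using h

/-- **Two exactly transported classes already kill a TV-close encoder** (`d = 1`, `ε < 1/2`): if `p₁`,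
`p₂` are both `ε`-close from above to `q` and carried by DISJOINT events, contradiction.  Hence an encoder
of the registered kit (total variation `1/16` to one certified law per length) cannot map two same-length
yes-instances into disjoint target classes with certainty — no entropy-exact (up to a shift of the
length), orbit-preserving or class-preserving encoder. [ApplebaumRaykov2016, Thm. 1; FeigenbaumFortnow1993] -/
theorem not_close_of_carried_disjoint (q p₁ p₂ : PMF α) {E₁ E₂ : Set α} {ε : ℝ} (hε : ε < 1 / 2)
    (hdisj : Disjoint E₁ E₂) (hc₁ : (p₁.toOuterMeasure E₁).toReal = 1)
    (hc₂ : (p₂.toOuterMeasure E₂).toReal = 1)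
    (h₁ : ∀ F : Set α, (p₁.toOuterMeasure F).toReal ≤ (q.toOuterMeasure F).toReal + ε)
    (h₂ : ∀ F : Set α, (p₂.toOuterMeasure F).toReal ≤ (q.toOuterMeasure F).toReal + ε) : False :=
  not_close_of_mostly_carried_disjoint q p₁ p₂ (η := 0) (by linarith) hdisj (by rw [hc₁]; norm_num)
    (by rw [hc₂]; norm_num) h₁ h₂

/-- **An exactly transported invariant is constant** (contrapositive form used for kits): if `p₁`, `p₂`
are `ε`-close from above to the same `q` (`ε < 1/2`) and `p₁` is carried by `{y | inv y = c₁}`, `p₂` by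
`{y | inv y = c₂}`, then `c₁ = c₂`. [ApplebaumRaykov2016, Thm. 1; FeigenbaumFortnow1993] -/
theorem eq_of_close_of_carried {β : Type*} (q p₁ p₂ : PMF α) (inv : α → β) {c₁ c₂ : β} {ε : ℝ}
    (hε : ε < 1 / 2) (hc₁ : (p₁.toOuterMeasure {y | inv y = c₁}).toReal = 1)
    (hc₂ : (p₂.toOuterMeasure {y | inv y = c₂}).toReal = 1)
    (h₁ : ∀ F : Set α, (p₁.toOuterMeasure F).toReal ≤ (q.toOuterMeasure F).toReal + ε)
    (h₂ : ∀ F : Set α, (p₂.toOuterMeasure F).toReal ≤ (q.toOuterMeasure F).toReal + ε) : c₁ = c₂ := by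
  by_contra hne
  refine not_close_of_carried_disjoint q p₁ p₂ hε ?_ hc₁ hc₂ h₁ h₂
  exact Set.disjoint_left.2 fun y (hy₁ : inv y = c₁) (hy₂ : inv y = c₂) => hne (hy₁.symm.trans hy₂)

/-- **Mode-preservation forces statistical separation.** If `p` is `ε`-close from above to a law `qY`
that gives the event `N` mass `0`, and `p'` is `ε`-close from above to a law `qN` carried by `N`, then
`p'(N) - p(N) ≥ 1 - 2ε`.  For a kit: the encoder's laws on a yes- and a no-instance of the same length are
`≥ 1 - 2ε` apart in total variation (`7/8` at `ε = 1/16`) — `enc` is a statistical decision procedure for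
the promise (the randomized-encoding "correctness" that must coexist with "privacy").
[ApplebaumRaykov2016, Thm. 1 and 3] -/
theorem sub_le_of_close_to_separated (p p' qY qN : PMF α) (N : Set α) {ε : ℝ}
    (hY : (qY.toOuterMeasure N).toReal = 0) (hN : (qN.toOuterMeasure Nᶜ).toReal = 0)
    (h : ∀ F : Set α, (p.toOuterMeasure F).toReal ≤ (qY.toOuterMeasure F).toReal + ε)
    (h' : ∀ F : Set α, (p'.toOuterMeasure F).toReal ≤ (qN.toOuterMeasure F).toReal + ε) :
    1 - 2 * ε ≤ (p'.toOuterMeasure N).toReal - (p.toOuterMeasure N).toReal := by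
  have h1 : (p.toOuterMeasure N).toReal ≤ ε := by simpa [hY] using h N
  have h2 : (p'.toOuterMeasure Nᶜ).toReal ≤ ε := by simpa [hN] using h' Nᶜ
  have h3 := toReal_toOuterMeasure_add_compl p' N
  linarith

/-- Support form of the side conditions (support `⊆ T`, `T ∩ F = ∅` ⇒ `F` has mass `0`). [folklore] -/
theorem toReal_toOuterMeasure_eq_zero_of_support_subset (q : PMF α) {T F : Set α}
    (hT : ∀ w ∈ q.support, w ∈ T) (hTF : Disjoint T F) : (q.toOuterMeasure F).toReal = 0 := by
  rw [(PMF.toOuterMeasure_apply_eq_zero_iff _ _).2 (Set.disjoint_left.2 fun w hw hF =>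
    Set.disjoint_left.1 hTF (hT w hw) hF), ENNReal.toReal_zero]

/-- An atom of the encoder is an atom of the certified law: `q{y} ≥ p{y} - ε`. [folklore] -/
theorem le_apply_of_atom_close (p q : PMF α) (y : α) {ε : ℝ}
    (h : ∀ F : Set α, (p.toOuterMeasure F).toReal ≤ (q.toOuterMeasure F).toReal + ε) :
    (p y).toReal - ε ≤ (q y).toReal := by
  have := h {y}
  rw [PMF.toOuterMeasure_apply_singleton, PMF.toOuterMeasure_apply_singleton] at this
  linarith

/-- **A point mass `ε`-close to `q` sits on a `(1-ε)`-atom of `q`.** [folklore] -/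
theorem le_apply_of_pure_close (q : PMF α) (y : α) {ε : ℝ}
    (h : ∀ F : Set α, ((PMF.pure y).toOuterMeasure F).toReal ≤ (q.toOuterMeasure F).toReal + ε) :
    1 - ε ≤ (q y).toReal := by
  have := le_apply_of_atom_close (PMF.pure y) q y h
  rwa [PMF.pure_apply, if_pos rfl, ENNReal.toReal_one] at this

/-- **Deterministic encoders collapse**: two point masses both `ε`-close from above (`ε < 1/2`) to the
same law coincide.  For a coin-free mode kit: `enc` is CONSTANT on the yes-instances of each length (and
on the no-instances), its value a `(1-ε)`-atom of `samp true` (resp. `samp false`) at that length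
(`le_apply_of_pure_close`) — so `x ↦ [enc x = a fresh sample of samp true (1^{|x|})]` decides `PEA₃` in
`PromiseBPP'` with error `≤ ε`; under the crux's hypothesis a kit's encoder must be randomized.
[ApplebaumRaykov2016, Thm. 3; Goldreich2006, Def. 1.2] -/
theorem pure_eq_of_close (q : PMF α) (y₁ y₂ : α) {ε : ℝ} (hε : ε < 1 / 2)
    (h₁ : ∀ F : Set α, ((PMF.pure y₁).toOuterMeasure F).toReal ≤ (q.toOuterMeasure F).toReal + ε)
    (h₂ : ∀ F : Set α, ((PMF.pure y₂).toOuterMeasure F).toReal ≤ (q.toOuterMeasure F).toReal + ε) :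
    y₁ = y₂ := by
  refine eq_of_close_of_carried q (PMF.pure y₁) (PMF.pure y₂) id hε ?_ ?_ h₁ h₂
  · rw [PMF.toOuterMeasure_pure_apply, if_pos (show y₁ ∈ {y | id y = y₁} from rfl), ENNReal.toReal_one]
  · rw [PMF.toOuterMeasure_pure_apply, if_pos (show y₂ ∈ {y | id y = y₂} from rfl), ENNReal.toReal_one]


/-! ### Two same-length yes-instances of `PEA` with different entropies -/


/-- `(x₂, x₃)` on `F₂⁴` is the product of the empty map on `F₂²` with the identity of `F₂²`. [folklore] -/
theorem projFour_eq_prod :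
    ([[[2]], [[3]]] : PolyMapF2 4) = PolyMapF2.prod ([] : PolyMapF2 2) ([[[0]], [[1]]] : PolyMapF2 2) := by
  decide

/-- `(x₂, x₂)` on `F₂⁴` is the product of the empty map on `F₂²` with `(x₀, x₀)` on `F₂²`. [folklore] -/
theorem dupFour_eq_prod :
    ([[[2]], [[2]]] : PolyMapF2 4) = PolyMapF2.prod ([] : PolyMapF2 2) ([[[0]], [[0]]] : PolyMapF2 2) := by
  decide

/-- `H(x ↦ (x₀, x₁)` on `F₂²) = 2` (injective: `log₂ 4`). [DvirGutfreundRothblumVadhan2010, Claim 2.2] -/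
theorem entropy_idTwo : PolyMapF2.entropy ([[[0]], [[1]]] : PolyMapF2 2) = 2 := by
  have hinj : Function.Injective (PolyMapF2.eval ([[[0]], [[1]]] : PolyMapF2 2)) := by
    intro x y hxy
    have h : [x 0, x 1] = [y 0, y 1] := by simpa [PolyMapF2.eval] using hxy
    simp only [List.cons.injEq, and_true] at h
    funext i
    fin_cases i
    · exact h.1
    · exact h.2
  rw [PolyMapF2.entropy, mapEntropy_of_injective _ hinj, Finset.card_univ, Fintype.card_fun,
    ZMod.card, Fintype.card_fin]
  rw [show ((2 ^ 2 : ℕ) : ℝ) = 2 ^ (2 : ℝ) by norm_num, Real.logb_rpow (by norm_num) (by norm_num)]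

/-- `H(x ↦ x₀` on `F₂¹) = 1`. [DvirGutfreundRothblumVadhan2010, Claim 2.2] -/
theorem entropy_idOne : PolyMapF2.entropy ([[[0]]] : PolyMapF2 1) = 1 := by
  have hinj : Function.Injective (PolyMapF2.eval ([[[0]]] : PolyMapF2 1)) := by
    intro x y hxy
    have h0 : x 0 = y 0 := by simpa [PolyMapF2.eval] using hxy
    funext i
    have hi : i = 0 := Subsingleton.elim i 0
    rw [hi, h0]
  rw [PolyMapF2.entropy, mapEntropy_of_injective _ hinj, Finset.card_univ, Fintype.card_fun,
    ZMod.card, Fintype.card_fin]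
  norm_num

/-- `H(x ↦ x₀` on `F₂²) = 1` (product of the identity on `F₂¹` with the empty map on `F₂¹`, `entropy_prod`). [DvirGutfreundRothblumVadhan2010, §3 p. 6] -/
theorem entropy_projTwo : PolyMapF2.entropy ([[[0]]] : PolyMapF2 2) = 1 := by
  have h : ([[[0]]] : PolyMapF2 2) = PolyMapF2.prod ([[[0]]] : PolyMapF2 1) ([] : PolyMapF2 1) := by decide
  rw [h, PolyMapF2.entropy_prod, entropy_idOne, PolyMapF2.entropy_nil, add_zero]

/-- `H(x ↦ (x₀, x₀)` on `F₂²) = 1` (injective post-processing of `x ↦ x₀`). [DvirGutfreundRothblumVadhan2010, Claim 2.2] -/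
theorem entropy_dupTwo : PolyMapF2.entropy ([[[0]], [[0]]] : PolyMapF2 2) = 1 := by
  have hcomp : PolyMapF2.eval ([[[0]], [[0]]] : PolyMapF2 2) =
      (fun l : List (ZMod 2) => l ++ l) ∘ PolyMapF2.eval ([[[0]]] : PolyMapF2 2) := by
    funext x
    simp [PolyMapF2.eval]
  rw [PolyMapF2.entropy, hcomp, mapEntropy_comp_of_injOn]
  · exact entropy_projTwo
  · intro a _ b _ hab
    have ha : (PolyMapF2.eval ([[[0]]] : PolyMapF2 2) a) = [a 0] := by simp [PolyMapF2.eval]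
    have hb : (PolyMapF2.eval ([[[0]]] : PolyMapF2 2) b) = [b 0] := by simp [PolyMapF2.eval]
    rw [ha, hb] at hab ⊢
    simpa using hab

/-- **The projection instance has entropy `2`.** [DvirGutfreundRothblumVadhan2010, §3 p. 6] -/
theorem entropy_peaProjInst : PolyMapF2.entropy (⟨4, ([[[2]], [[3]]], 0)⟩ : PEAInst).2.1 = 2 := by
  show PolyMapF2.entropy ([[[2]], [[3]]] : PolyMapF2 4) = 2
  rw [projFour_eq_prod, PolyMapF2.entropy_prod, PolyMapF2.entropy_nil, entropy_idTwo, zero_add]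

/-- **The duplication instance has entropy `1`.** [DvirGutfreundRothblumVadhan2010, §3 p. 6] -/
theorem entropy_peaDupInst : PolyMapF2.entropy (⟨4, ([[[2]], [[2]]], 0)⟩ : PEAInst).2.1 = 1 := by
  show PolyMapF2.entropy ([[[2]], [[2]]] : PolyMapF2 4) = 1
  rw [dupFour_eq_prod, PolyMapF2.entropy_prod, PolyMapF2.entropy_nil, entropy_dupTwo, zero_add]

/-- The projection instance has degree `≤ 1 ≤ d`. [folklore] -/
theorem degLE_peaProjInst {d : ℕ} (hd : 1 ≤ d) : PolyMapF2.DegLE d (⟨4, ([[[2]], [[3]]], 0)⟩ : PEAInst).2.1 := by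
  have h1 : PolyMapF2.DegLE 1 (⟨4, ([[[2]], [[3]]], 0)⟩ : PEAInst).2.1 := by
    unfold PolyMapF2.DegLE
    decide
  exact h1.mono hd

/-- The duplication instance has degree `≤ 1 ≤ d`. [folklore] -/
theorem degLE_peaDupInst {d : ℕ} (hd : 1 ≤ d) : PolyMapF2.DegLE d (⟨4, ([[[2]], [[2]]], 0)⟩ : PEAInst).2.1 := by
  have h1 : PolyMapF2.DegLE 1 (⟨4, ([[[2]], [[2]]], 0)⟩ : PEAInst).2.1 := by
    unfold PolyMapF2.DegLE
    decide
  exact h1.mono hd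

/-- **The projection instance `(x ↦ (x₂,x₃), k = 0)` is a YES instance of every `PEA d`, `d ≥ 1`.** [DvirGutfreundRothblumVadhan2010, §3 p. 6] -/
theorem encode_peaProjInst_mem_yes {d : ℕ} (hd : 1 ≤ d) :
    PEAInst.encoding.encode (⟨4, ([[[2]], [[3]]], 0)⟩ : PEAInst) ∈ (PEA d).yes := by
  refine (encode_mem_PEA_yes_iff d _).2 ⟨degLE_peaProjInst hd, ?_⟩
  rw [entropy_peaProjInst]
  show ((0 : ℕ) : ℝ) + 1 ≤ 2
  norm_num

/-- **The duplication instance `(x ↦ (x₂,x₂), k = 0)` is a YES instance of every `PEA d`, `d ≥ 1`.** [DvirGutfreundRothblumVadhan2010, §3 p. 6] -/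
theorem encode_peaDupInst_mem_yes {d : ℕ} (hd : 1 ≤ d) :
    PEAInst.encoding.encode (⟨4, ([[[2]], [[2]]], 0)⟩ : PEAInst) ∈ (PEA d).yes := by
  refine (encode_mem_PEA_yes_iff d _).2 ⟨degLE_peaDupInst hd, ?_⟩
  rw [entropy_peaDupInst]
  show ((0 : ℕ) : ℝ) + 1 ≤ 1
  norm_num

set_option maxRecDepth 20000 in
/-- **The two instances have codes of the SAME length** (`238` bits: the variable indices `2`, `3` both have
2-bit binary codes). [AroraBarak2009, §0.1] -/
theorem length_encode_peaProjInst_eq :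
    (PEAInst.encoding.encode (⟨4, ([[[2]], [[3]]], 0)⟩ : PEAInst)).length = (PEAInst.encoding.encode (⟨4, ([[[2]], [[2]]], 0)⟩ : PEAInst)).length := by
  decide



/-- **The two witnesses**: both YES for `PEA d` (`d ≥ 1`), same code length, entropies `2` and `1`.
[DvirGutfreundRothblumVadhan2010, §3 p. 6] -/
theorem pea_witnesses_spec {d : ℕ} (hd : 1 ≤ d) :
    PEAInst.encoding.encode (⟨4, ([[[2]], [[3]]], 0)⟩ : PEAInst) ∈ (PEA d).yes ∧
      PEAInst.encoding.encode (⟨4, ([[[2]], [[2]]], 0)⟩ : PEAInst) ∈ (PEA d).yes ∧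
      (PEAInst.encoding.encode (⟨4, ([[[2]], [[3]]], 0)⟩ : PEAInst)).length =
        (PEAInst.encoding.encode (⟨4, ([[[2]], [[2]]], 0)⟩ : PEAInst)).length ∧
      PolyMapF2.entropy (⟨4, ([[[2]], [[3]]], 0)⟩ : PEAInst).2.1 = 2 ∧
      PolyMapF2.entropy (⟨4, ([[[2]], [[2]]], 0)⟩ : PEAInst).2.1 = 1 :=
  ⟨encode_peaProjInst_mem_yes hd, encode_peaDupInst_mem_yes hd, length_encode_peaProjInst_eq,
    entropy_peaProjInst, entropy_peaDupInst⟩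

/-! ### Consequence for `PEA₃`: no entropy-exact mode-preserving encoder -/

/-- **No entropy-exact encoder for `PEA_d`, `d ≥ 1`.**  Let `ν x` be the output law of an encoder on the
instance string `x` and suppose that on YES instances it is `ε`-close from above (`ε < 1/2`) to a law
`μ |x|` depending only on the LENGTH of `x` (the kit's `samp true (1^{|x|})`).  Then `ν` cannot transport
the source entropy exactly: for NO readout `Ht` of "target entropy" and NO shift `s` of the length is
`ν x` carried by `{w | Ht w = H(x) + s |x|}` for every yes-instance `x` (`Hs` any function reading the true
entropy off instance codes).  Witness: the yes-instances `(x ↦ (x₂,x₃), 0)` and `(x ↦ (x₂,x₂), 0)` on `F₂⁴`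
have equal code length and entropies `2 ≠ 1` (`eq_of_close_of_carried`).  This excludes, for the registered
`ModeKit` (`ε = 1/16`), every entropy-EXACT encoder — `GL`/affine re-randomisation, direct sums and
products with fixed maps, perfect randomized (AIK) re-encodings of the given map, and their compositions
(all shift the entropy by a function of the length only). [DvirGutfreundRothblumVadhan2010, pp. 2–3 and
Thm. 4.5; ApplebaumRaykov2016, Thm. 1; FeigenbaumFortnow1993] -/
theorem pea_no_entropyExact_encoder {d : ℕ} (hd : 1 ≤ d) (Hs : List Bool → ℝ)
    (hHs : ∀ I : PEAInst, Hs (PEAInst.encoding.encode I) = PolyMapF2.entropy I.2.1)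
    (ν : List Bool → PMF (List Bool)) (μ : ℕ → PMF (List Bool)) {ε : ℝ} (hε : ε < 1 / 2)
    (hclose : ∀ x ∈ (PEA d).yes, ∀ F : Set (List Bool),
      ((ν x).toOuterMeasure F).toReal ≤ ((μ x.length).toOuterMeasure F).toReal + ε)
    (Ht : List Bool → ℝ) (s : ℕ → ℝ) :
    ¬ ∀ x ∈ (PEA d).yes, ((ν x).toOuterMeasure {w | Ht w = Hs x + s x.length}).toReal = 1 := by
  intro hexact
  obtain ⟨hy₁, hy₂, hlen, hH₁, hH₂⟩ := pea_witnesses_spec hd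
  have h := eq_of_close_of_carried (μ _) (ν _) (ν _) Ht hε (hexact _ hy₁) (hexact _ hy₂)
    (fun F => by simpa only [hlen] using hclose _ hy₁ F) (hclose _ hy₂)
  rw [hHs, hHs, hH₁, hH₂, hlen] at h
  linarith

/-- **Nor can it transport ANY exact invariant that separates the two witnesses**: if an encoder as above
carries every yes-instance `x` into the class `{w | inv w = val x}` of a target invariant, then `val` takes
the same value on the projection and the duplication instance — so `val` is NOT a function of the entropy,
of the linear-algebraic rank profile, or of the `GL₄ × GL₂`-orbit of the instance (all of which separate
them). [FeigenbaumFortnow1993; ApplebaumRaykov2016, Thm. 1] -/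
theorem pea_exactInvariant_eq_on_witnesses {d : ℕ} (hd : 1 ≤ d) {β : Type*}
    (ν : List Bool → PMF (List Bool)) (μ : ℕ → PMF (List Bool)) {ε : ℝ} (hε : ε < 1 / 2)
    (hclose : ∀ x ∈ (PEA d).yes, ∀ F : Set (List Bool),
      ((ν x).toOuterMeasure F).toReal ≤ ((μ x.length).toOuterMeasure F).toReal + ε)
    (inv : List Bool → β) (val : List Bool → β)
    (hexact : ∀ x ∈ (PEA d).yes, ((ν x).toOuterMeasure {w | inv w = val x}).toReal = 1) :
    val (PEAInst.encoding.encode (⟨4, ([[[2]], [[3]]], 0)⟩ : PEAInst)) =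
      val (PEAInst.encoding.encode (⟨4, ([[[2]], [[2]]], 0)⟩ : PEAInst)) := by
  obtain ⟨hy₁, hy₂, hlen, -, -⟩ := pea_witnesses_spec hd
  exact eq_of_close_of_carried (μ _) (ν _) (ν _) inv hε (hexact _ hy₁) (hexact _ hy₂)
    (fun F => by simpa only [hlen] using hclose _ hy₁ F) (hclose _ hy₂)

/-- **`PEA` corollary, robust form**: no encoder `ε`-close per length to one law sends the projection
witness into a target class `C₁` and the duplication witness into a DISJOINT class `C₂` each with
probability `≥ 1 - η`, once `η + ε < 1/2` — e.g. "target entropy within `±1/4` of `H(x) + s(|x|)`" is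
impossible even with failure probability `η` (the two target windows `2 + s ± 1/4`, `1 + s ± 1/4` are
disjoint). [DvirGutfreundRothblumVadhan2010, pp. 2–3; ApplebaumRaykov2016, Thm. 1] -/
theorem pea_not_mostly_separated_witnesses {d : ℕ} (hd : 1 ≤ d)
    (ν : List Bool → PMF (List Bool)) (μ : ℕ → PMF (List Bool)) {ε η : ℝ} (hεη : η + ε < 1 / 2)
    (hclose : ∀ x ∈ (PEA d).yes, ∀ F : Set (List Bool),
      ((ν x).toOuterMeasure F).toReal ≤ ((μ x.length).toOuterMeasure F).toReal + ε)
    {C₁ C₂ : Set (List Bool)} (hC : Disjoint C₁ C₂)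
    (h₁ : 1 - η ≤ ((ν (PEAInst.encoding.encode (⟨4, ([[[2]], [[3]]], 0)⟩ : PEAInst))).toOuterMeasure C₁).toReal)
    (h₂ : 1 - η ≤ ((ν (PEAInst.encoding.encode (⟨4, ([[[2]], [[2]]], 0)⟩ : PEAInst))).toOuterMeasure C₂).toReal) :
    False := by
  obtain ⟨hy₁, hy₂, hlen, -, -⟩ := pea_witnesses_spec hd
  exact not_close_of_mostly_carried_disjoint (μ _) (ν _) (ν _) hεη hC h₁ h₂
    (fun F => by simpa only [hlen] using hclose _ hy₁ F) (hclose _ hy₂)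

end Summit.PneNP.PneNP.Theorems
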